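import Literature.Analysis.FluidPDE.EulerReynoldsLocalization
import Literature.Analysis.FluidPDE.EulerReynoldsTorusPlantingFields
import Literature.Analysis.FunctionSpaces.TorusCompactSupportZeroMean
import HarnessLib

/-!
# Planting a sink completion and a stirring cell in the flat three-torus

Analysis/FluidPDE support file (everything proved; no definitions, no named facts). The torus
scaffold of the point-sink construction (`Summits/AnomalousDissipation`, crux
`PointSink.SolitonTransplant`; vocabulary of De Lellis–Székelyhidi 2010, §2). Input, on `ℝ³`:

* a *sink completion* `(r₀, r₁, c, U, R)` of a germ `V`: `U = V` on `0 < |x| < r₀`, `R = 0` on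
  `|x| ≤ r₀`, rest state `(0, c·Id)` on `|x| ≥ r₁` (`r₁ ≤ 1/16`), `U, R` smooth and `R ≻ 0` on
  `|x| > r₀`, `U ∈ L²`, `R ∈ L¹(B_{r₁})`, `U` weakly divergence free, and the weak stationary
  Euler–Reynolds identity `∫ (⟪U, Dφ·U⟫ + R : ∇φ) = 0` for divergence-free `φ ∈ C_c^∞(ℝ³ ∖ {0})`;
* a *stirring cell* `(W, S, f)` at the ambient level `c` (`StirringCell.lean`), supported in
  `B(p, 1/16)`, `p = (⅛, ½, ½)`: smooth, `div W = div f = 0`, `c·Id + S ≻ 0`, the weak identity with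
  source `∫ (⟪W, Dφ·W⟫ + S : ∇φ + ⟪f, φ⟫) = 0` for all `φ ∈ C_c^∞`, and power `∫ ⟪f, W⟫ = D`.

Output (`exists_eulerReynolds_torusPlanting`), on `T³ = ℝ³/ℤ³` with the sink at
`x₀ = proj q`, `q = (½, ½, ½)`: the periodisations `U' = periodize (U(· − q) + W)`,
`R' = c·Id + periodize ((R(· − q) − c·Id) + S)`, `f' = periodize f` satisfy every clause of the
scaffold — `f'` smooth, divergence free, mean zero and `≡ 0` on the chart ball `|v| < r₁`; `U' = V`
on the punctured germ ball, `R' = 0` on the closed germ ball; `U', R'` smooth and `R' ≻ 0` at chart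
points farther than `r₀` from the lattice; `U' ∈ L²`, `R' ∈ L¹`, `U'` weakly divergence free; the
weak Euler–Reynolds identity with source `f'` against smooth divergence-free torus tests vanishing
near `x₀`; and the power `∫ ⟪f', U'⟫ = D`.

Proof. Cube bookkeeping is `EulerReynoldsTorusPlantingFields.lean`; integrals are moved between
`T³` and `ℝ³` through the fundamental cube (`Torus.integral_eq_integral_of_forall_proj_eq`). The
weak identity splits pointwise into a sink part and a cell part (disjoint supports); the periodic
lift of a torus test is localised on the sink by the tree's divergence-free truncation
(`integral_eulerReynolds_eq_zero_of_eqOn_ball`, via `SolenoidalTruncation`) and on the cell by a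
scalar cut-off (`integral_cell_eq_zero_of_forall_test`).

## References

* C. De Lellis, L. Székelyhidi Jr., Arch. Ration. Mech. Anal. 195 (2010), §2 (subsolutions).
* E. Bruè, C. De Lellis, Comm. Math. Phys. 400 (2023), §5 (cube-supported fields on the torus).
-/

noncomputable section

open MeasureTheory Set Function Filter Metric TopologicalSpace
open scoped RealInnerProductSpace ContDiff Topology
open Literature.Analysis.FunctionSpaces

namespace Literature.Analysis.FluidPDE

section Planting

variable {q p : EuclideanSpace ℝ (Fin 3)} {U W f : EuclideanSpace ℝ (Fin 3) → EuclideanSpace ℝ (Fin 3)}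
  {R S : EuclideanSpace ℝ (Fin 3) → Fin 3 → Fin 3 → ℝ} {r₀ r₁ c : ℝ}
  {Uc : EuclideanSpace ℝ (Fin 3) → EuclideanSpace ℝ (Fin 3)}
  {Sc : EuclideanSpace ℝ (Fin 3) → Fin 3 → Fin 3 → ℝ}

/-! ### Weak divergence-freeness of the planted velocity -/

/-- **The planted velocity is weakly divergence free on `T³`.** Against a smooth `θ` on the torus,
`∫ ⟪U', ∇θ⟫ = ∫_{ℝ³} ⟪U(· − q) + W, ∇θ̃⟫` (`θ̃` the periodic lift); the `W`-part vanishes by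
integration by parts (`div W = 0`, `W` compactly supported), the `U`-part after inserting a cut-off
equal to `1` on the support of `U(· − q)` and translating, by the weak divergence-freeness of `U`.
[folklore] -/
theorem isWeaklyDivFree_periodize_cubeVelocity (hq : ∀ i, q i = 1 / 2)
    (hp : ∀ i, p i = if i = 0 then 1 / 8 else 1 / 2) (hr₁ : 0 < r₁) (hr₁' : r₁ ≤ 1 / 16)
    (hrest : ∀ x : EuclideanSpace ℝ (Fin 3), r₁ ≤ ‖x‖ →
      U x = 0 ∧ R x = fun i j => if i = j then c else 0)
    (hwdiv : ∀ θ : EuclideanSpace ℝ (Fin 3) → ℝ, ContDiff ℝ ∞ θ → HasCompactSupport θ →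
      ∫ x, ⟪U x, gradient θ x⟫ = 0)
    (hW : ContDiff ℝ ∞ W) (hWs : tsupport W ⊆ ball p (1 / 16)) (hfs : tsupport f ⊆ ball p (1 / 16))
    (hSs : tsupport S ⊆ ball p (1 / 16)) (hWdiv : ∀ x, VectorCalculus.divergence W x = 0)
    (hUc : Uc = fun y => U (y - q) + W y)
    (hSc : Sc = fun y i j => (R (y - q) i j - if i = j then c else 0) + S y i j) :
    Torus.IsWeaklyDivFree (Torus.periodize Uc) := by
  intro θ hθ
  obtain ⟨hUc0, -, -⟩ :=
    cubeFields_eq_zero_of_not_mem_openCube hq hp hr₁' hrest hWs hfs hSs hUc hSc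
  set θl : EuclideanSpace ℝ (Fin 3) → ℝ := Torus.lift θ with hθl
  have hθls : ContDiff ℝ ∞ θl := hθ
  -- transfer to the cube
  have htr : ∫ x, ⟪Torus.periodize Uc x, Torus.gradient θ x⟫ = ∫ y, ⟪Uc y, gradient θl y⟫ := by
    refine Torus.integral_eq_integral_of_forall_proj_eq (fun y hy => ?_) (fun y hy => ?_)
    · rw [Torus.periodize_proj, Torus.perSum_eq_self_of_mem_unitCube hUc0 hy, hθl,
        Torus.gradient_lift]
    · rw [hUc0 y (fun h => hy fun i => Ioo_subset_Ico_self (h i)), inner_zero_left]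
  rw [htr]
  -- the `W`-part: integration by parts
  have hWc : HasCompactSupport W := HasCompactSupport.of_support_subset_isCompact
    (isCompact_closedBall p (1 / 16)) ((subset_tsupport W).trans (hWs.trans ball_subset_closedBall))
  have h2 : ∫ y, ⟪W y, gradient θl y⟫ = 0 := by
    have h := integral_mul_divergence_add_eq_zero_right (hθls.of_le (by norm_cast))
      (hW.of_le (by norm_cast)) hWc
    simp_rw [hWdiv, mul_zero, integral_zero, zero_add] at h
    exact h
  have h2i : Integrable (fun y => ⟪W y, gradient θl y⟫) (volume : Measure (EuclideanSpace ℝ (Fin 3))) :=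
    (hW.continuous.inner (continuous_gradient_of_contDiff (hθls.of_le (by norm_cast))))
      |>.integrable_of_hasCompactSupport (hWc.mono fun y hy => by
        contrapose! hy
        simp only [mem_support, not_not] at hy ⊢
        rw [hy, inner_zero_left])
  -- the `U`-part: cut off and translate
  have h1 : ∫ y, ⟪U (y - q), gradient θl y⟫ = 0 := by
    let χ : ContDiffBump q := ⟨r₁, 2 * r₁, hr₁, by linarith⟩
    set η : EuclideanSpace ℝ (Fin 3) → ℝ := fun y => χ y * θl y with hη
    have hηs : ContDiff ℝ ∞ η := χ.contDiff.mul hθls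
    have hηc : HasCompactSupport η := χ.hasCompactSupport.mul_right
    have hpt : ∀ y, ⟪U (y - q), gradient θl y⟫ = ⟪U (y - q), gradient η y⟫ := by
      intro y
      by_cases hy : ‖y - q‖ < r₁
      · have hloc : η =ᶠ[𝓝 y] θl := by
          have hy' : y ∈ ball q r₁ := by rwa [mem_ball, dist_eq_norm]
          filter_upwards [isOpen_ball.mem_nhds hy'] with z hz
          rw [hη]
          simp only
          rw [χ.one_of_mem_closedBall (ball_subset_closedBall hz), one_mul]
        rw [hloc.gradient_eq]
      · rw [(hrest _ (not_lt.1 hy)).1, inner_zero_left, inner_zero_left]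
    simp_rw [hpt]
    have htrans : ∫ y, ⟪U (y - q), gradient η y⟫ = ∫ v, ⟪U v, gradient η (v + q)⟫ := by
      rw [← integral_add_right_eq_self (fun y => ⟪U (y - q), gradient η y⟫) q]
      simp only [add_sub_cancel_right]
    rw [htrans]
    have hgrad : ∀ v, gradient η (v + q) = gradient (fun v => η (v + q)) v := fun v => by
      simp only [gradient, fderiv_comp_add_right]
    simp_rw [hgrad]
    exact hwdiv _ (hηs.comp (contDiff_id.add contDiff_const))
      (hηc.comp_homeomorph (Homeomorph.addRight q))
  -- combine
  have hsum : (fun y => ⟪Uc y, gradient θl y⟫) =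
      fun y => ⟪U (y - q), gradient θl y⟫ + ⟪W y, gradient θl y⟫ := by
    funext y
    rw [hUc, inner_add_left]
  rw [hsum]
  by_cases h1i : Integrable (fun y => ⟪U (y - q), gradient θl y⟫) (volume : Measure (EuclideanSpace ℝ (Fin 3)))
  · rw [integral_add h1i h2i, h1, h2, add_zero]
  · refine integral_undef fun h => h1i ?_
    have h' : Integrable ((fun y => ⟪U (y - q), gradient θl y⟫) + fun y => ⟪W y, gradient θl y⟫)
        (volume : Measure (EuclideanSpace ℝ (Fin 3))) := h
    exact (integrable_add_iff_integrable_left h2i).1 h'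

/-! ### The weak Euler–Reynolds identity with source on the torus -/

/-- **The planted pair is a weak Euler–Reynolds subsolution with source `f'` off the sink.** For
every smooth divergence-free torus test `w` vanishing on a chart ball around `x₀ = proj q`,
`∫ (⟪U', (U'·∇)w⟫ + R' : ∇w + ⟪f', w⟫) = 0` with `U' = periodize U_c`, `R' = c·Id + periodize S_c`,
`f' = periodize f`. The torus integral is the integral over `ℝ³` of the cube integrand (the
constant stress pairs to `c div w = 0`), which splits pointwise into the sink part (tested, after
translation, through `integral_eulerReynolds_eq_zero_of_eqOn_ball`) and the cell part
(`integral_cell_eq_zero_of_forall_test`). [folklore] -/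
theorem integral_eulerReynolds_periodize_eq_zero (hq : ∀ i, q i = 1 / 2)
    (hp : ∀ i, p i = if i = 0 then 1 / 8 else 1 / 2) (hr₁ : 0 < r₁) (hr₁' : r₁ ≤ 1 / 16)
    (hrest : ∀ x : EuclideanSpace ℝ (Fin 3), r₁ ≤ ‖x‖ →
      U x = 0 ∧ R x = fun i j => if i = j then c else 0)
    (hweak : ∀ φ : EuclideanSpace ℝ (Fin 3) → EuclideanSpace ℝ (Fin 3),
      IsTestFunctionOn ⟨{x : EuclideanSpace ℝ (Fin 3) | x ≠ 0}, isOpen_ne⟩ φ →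
      (∀ x, VectorCalculus.divergence φ x = 0) →
      ∫ x, (⟪U x, fderiv ℝ φ x (U x)⟫ +
        ∑ i, ∑ j, R x i j * fderiv ℝ φ x (EuclideanSpace.single j 1) i) = 0)
    (hW : ContDiff ℝ ∞ W) (hf : ContDiff ℝ ∞ f) (hS : ContDiff ℝ ∞ S)
    (hWs : tsupport W ⊆ ball p (1 / 16)) (hfs : tsupport f ⊆ ball p (1 / 16))
    (hSs : tsupport S ⊆ ball p (1 / 16))
    (hcell : ∀ φ : EuclideanSpace ℝ (Fin 3) → EuclideanSpace ℝ (Fin 3), ContDiff ℝ ∞ φ →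
      HasCompactSupport φ →
      ∫ x, (⟪W x, fderiv ℝ φ x (W x)⟫ +
        ∑ i, ∑ j, S x i j * fderiv ℝ φ x (EuclideanSpace.single j 1) i + ⟪f x, φ x⟫) = 0)
    (hUc : Uc = fun y => U (y - q) + W y)
    (hSc : Sc = fun y i j => (R (y - q) i j - if i = j then c else 0) + S y i j)
    (w : UnitAddTorus (Fin 3) → EuclideanSpace ℝ (Fin 3)) (hw : Torus.IsSmooth w)
    (hwdiv : Torus.IsDivFree w)
    (hw0 : ∃ δ : ℝ, 0 < δ ∧ ∀ v : EuclideanSpace ℝ (Fin 3), ‖v‖ < δ →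
      Torus.liftAt w (Torus.proj q) v = 0) :
    ∫ x, (⟪Torus.periodize Uc x, Torus.convect (Torus.periodize Uc) w x⟫ +
      ∑ i, ∑ j, ((if i = j then c else 0) + Torus.periodize Sc x i j) *
        Torus.partialDeriv j w x i + ⟪Torus.periodize f x, w x⟫) = 0 := by
  obtain ⟨δ, hδ, hw0⟩ := hw0
  obtain ⟨hUc0, hSc0, hf0⟩ :=
    cubeFields_eq_zero_of_not_mem_openCube hq hp hr₁' hrest hWs hfs hSs hUc hSc
  set wl : EuclideanSpace ℝ (Fin 3) → EuclideanSpace ℝ (Fin 3) := Torus.lift w with hwl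
  have hwls : ContDiff ℝ ∞ wl := hw
  have hw1 : Torus.IsContDiff 1 w := hw.isContDiff (by simp)
  have hdivl : ∀ y, VectorCalculus.divergence wl y = 0 :=
    (Torus.isDivFree_iff_trace_fderiv_lift hw1).1 hwdiv
  -- the cube integrand splits pointwise into a sink part and a cell part (disjoint supports)
  set Ψ₁ : EuclideanSpace ℝ (Fin 3) → ℝ := fun y => ⟪U (y - q), fderiv ℝ wl y (U (y - q))⟫ +
    ∑ i, ∑ j, (R (y - q) i j - if i = j then c else 0) *
      fderiv ℝ wl y (EuclideanSpace.single j 1) i with hΨ₁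
  set Ψ₂ : EuclideanSpace ℝ (Fin 3) → ℝ := fun y => ⟪W y, fderiv ℝ wl y (W y)⟫ +
    ∑ i, ∑ j, S y i j * fderiv ℝ wl y (EuclideanSpace.single j 1) i + ⟪f y, wl y⟫ with hΨ₂
  have hsplit : ∀ y, ⟪Uc y, fderiv ℝ wl y (Uc y)⟫ +
      ∑ i, ∑ j, Sc y i j * fderiv ℝ wl y (EuclideanSpace.single j 1) i + ⟪f y, wl y⟫ =
      Ψ₁ y + Ψ₂ y := by
    intro y
    by_cases hy : y ∈ ball p (1 / 16)
    · have hfar : r₁ ≤ ‖y - q‖ :=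
        le_trans (by linarith) (le_norm_sub_centre_of_mem_ball_cellCentre hq hp hy)
      obtain ⟨hU, hR⟩ := hrest _ hfar
      simp [hΨ₁, hΨ₂, hUc, hSc, hU, hR]
    · have hW0 : W y = 0 := image_eq_zero_of_notMem_tsupport fun h => hy (hWs h)
      have hS0 : S y = 0 := image_eq_zero_of_notMem_tsupport fun h => hy (hSs h)
      have hf00 : f y = 0 := image_eq_zero_of_notMem_tsupport fun h => hy (hfs h)
      simp [hΨ₁, hΨ₂, hUc, hSc, hW0, hS0, hf00]
  -- transfer the torus integral to the cube
  have htr : ∫ x, (⟪Torus.periodize Uc x, Torus.convect (Torus.periodize Uc) w x⟫ +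
      ∑ i, ∑ j, ((if i = j then c else 0) + Torus.periodize Sc x i j) *
        Torus.partialDeriv j w x i + ⟪Torus.periodize f x, w x⟫) = ∫ y, (Ψ₁ y + Ψ₂ y) := by
    refine Torus.integral_eq_integral_of_forall_proj_eq (fun y hy => ?_) (fun y hy => ?_)
    · have hD : Torus.fderiv w (Torus.proj y) = fderiv ℝ wl y := by
        rw [hwl]
        exact (Torus.fderiv_lift w y).symm
      rw [← hsplit y]
      simp only [Torus.convect, hD, Torus.periodize_proj,
        Torus.perSum_eq_self_of_mem_unitCube hUc0 hy, Torus.perSum_eq_self_of_mem_unitCube hSc0 hy,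
        Torus.perSum_eq_self_of_mem_unitCube hf0 hy, Torus.partialDeriv_apply_eq_fderiv_apply hw1,
        add_mul, Finset.sum_add_distrib, sum_sum_ite_mul_fderiv_apply_eq, hdivl y, mul_zero,
        zero_add]
      simp [hwl]
    · have hy' : ¬ ∀ i, y i ∈ Ioo (0 : ℝ) 1 := fun h => hy fun i => Ioo_subset_Ico_self (h i)
      obtain ⟨⟨hU, hR⟩, hW0, hS0, hf00⟩ := sink_cell_eq_of_not_mem_openCube hq hp hr₁' hrest hWs hfs hSs hy'
      simp [hΨ₁, hΨ₂, hU, hR, hW0, hS0, hf00]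
  rw [htr]
  -- the cell part
  have h2 : ∫ y, Ψ₂ y = 0 := integral_cell_eq_zero_of_forall_test (by norm_num) hWs hfs hSs hcell hwls
  -- the sink part: translate to the sink frame and localise
  have h1 : ∫ y, Ψ₁ y = 0 := by
    rw [← integral_add_right_eq_self Ψ₁ q]
    set wq : EuclideanSpace ℝ (Fin 3) → EuclideanSpace ℝ (Fin 3) := fun v => wl (v + q) with hwq
    have hwqs : ContDiff ℝ ∞ wq := hwls.comp (contDiff_id.add contDiff_const)
    have hDq : ∀ v, fderiv ℝ wq v = fderiv ℝ wl (v + q) := fun v => fderiv_comp_add_right q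
    have hdivq : ∀ v, VectorCalculus.divergence wq v = 0 := fun v => by
      unfold VectorCalculus.divergence
      rw [hDq]
      exact hdivl (v + q)
    have hwq0 : ∀ v : EuclideanSpace ℝ (Fin 3), ‖v‖ < δ → wq v = 0 := fun v hv => by
      have h := hw0 v hv
      rw [Torus.liftAt_apply, ← Torus.proj_add] at h
      simpa [hwq, hwl, add_comm] using h
    have key := integral_eulerReynolds_eq_zero_of_eqOn_ball hr₁ hrest hweak hwqs hdivq hδ hwq0
    simp_rw [hDq] at key
    simpa [hΨ₁] using key
  -- combine (the cell part is integrable; if the sink part is not, both sides are junk `0`)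
  have hWc : HasCompactSupport W := HasCompactSupport.of_support_subset_isCompact
    (isCompact_closedBall p (1 / 16)) ((subset_tsupport W).trans (hWs.trans ball_subset_closedBall))
  have hLc : Continuous (fderiv ℝ wl) := hwls.continuous_fderiv (by simp)
  have h2c : Continuous Ψ₂ := by
    refine ((hW.continuous.inner (hLc.clm_apply hW.continuous)).add
      (continuous_finsetSum _ fun i _ => continuous_finsetSum _ fun j _ => ?_)).add
      (hf.continuous.inner hwls.continuous)
    exact ((continuous_apply j).comp ((continuous_apply i).comp hS.continuous)).mul
      ((EuclideanSpace.proj i).continuous.comp (hLc.clm_apply continuous_const))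
  have h2i : Integrable Ψ₂ (volume : Measure (EuclideanSpace ℝ (Fin 3))) := by
    refine h2c.integrable_of_hasCompactSupport (HasCompactSupport.intro
      (isCompact_closedBall p (1 / 16)) fun y hy => ?_)
    have hy' : y ∉ ball p (1 / 16) := fun h => hy (ball_subset_closedBall h)
    have hW0 : W y = 0 := image_eq_zero_of_notMem_tsupport fun h => hy' (hWs h)
    have hS0 : S y = 0 := image_eq_zero_of_notMem_tsupport fun h => hy' (hSs h)
    have hf00 : f y = 0 := image_eq_zero_of_notMem_tsupport fun h => hy' (hfs h)
    simp [hΨ₂, hW0, hS0, hf00]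
  by_cases h1i : Integrable Ψ₁ (volume : Measure (EuclideanSpace ℝ (Fin 3)))
  · rw [integral_add h1i h2i, h1, h2, add_zero]
  · refine integral_undef fun h => h1i ?_
    have h' : Integrable (Ψ₁ + Ψ₂) (volume : Measure (EuclideanSpace ℝ (Fin 3))) := h
    exact (integrable_add_iff_integrable_left h2i).1 h'

/-! ### The power -/

/-- **The power of the planted scaffold is the power of the cell**: `∫ ⟪f', U'⟫ = ∫ ⟪f, W⟫`
(the force lives in the cell ball, where the sink is at rest). [folklore] -/
theorem integral_inner_periodize_eq (hq : ∀ i, q i = 1 / 2)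
    (hp : ∀ i, p i = if i = 0 then 1 / 8 else 1 / 2) (hr₁' : r₁ ≤ 1 / 16)
    (hrest : ∀ x : EuclideanSpace ℝ (Fin 3), r₁ ≤ ‖x‖ →
      U x = 0 ∧ R x = fun i j => if i = j then c else 0)
    (hWs : tsupport W ⊆ ball p (1 / 16)) (hfs : tsupport f ⊆ ball p (1 / 16))
    (hSs : tsupport S ⊆ ball p (1 / 16)) (hUc : Uc = fun y => U (y - q) + W y)
    (hSc : Sc = fun y i j => (R (y - q) i j - if i = j then c else 0) + S y i j) :
    ∫ x, ⟪Torus.periodize f x, Torus.periodize Uc x⟫ = ∫ y, ⟪f y, W y⟫ := by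
  obtain ⟨hUc0, -, hf0⟩ :=
    cubeFields_eq_zero_of_not_mem_openCube hq hp hr₁' hrest hWs hfs hSs hUc hSc
  have hpt : ∀ y, ⟪f y, Uc y⟫ = ⟪f y, W y⟫ := fun y => by
    by_cases hy : y ∈ ball p (1 / 16)
    · have hfar : r₁ ≤ ‖y - q‖ :=
        le_trans (by linarith) (le_norm_sub_centre_of_mem_ball_cellCentre hq hp hy)
      rw [hUc]
      simp [(hrest _ hfar).1]
    · have hf00 : f y = 0 := image_eq_zero_of_notMem_tsupport fun h => hy (hfs h)
      simp [hf00]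
  refine Torus.integral_eq_integral_of_forall_proj_eq (fun y hy => ?_) (fun y hy => ?_)
  · rw [Torus.periodize_proj, Torus.periodize_proj, Torus.perSum_eq_self_of_mem_unitCube hUc0 hy,
      Torus.perSum_eq_self_of_mem_unitCube hf0 hy, hpt]
  · have hy' : ¬ ∀ i, y i ∈ Ioo (0 : ℝ) 1 := fun h => hy fun i => Ioo_subset_Ico_self (h i)
    rw [hf0 y hy', inner_zero_left]

end Planting

end Literature.Analysis.FluidPDE
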